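/-
Copyright (c) 2026 the pub-hodgecm-mathlib formalisation cell (harness21).  Prover seat hodgecm-mathlib-K2Liu-p03 (g6): Track B «K2-LIT»,
#184♮ = hLiu418 = stmt-HodgeConjecture-24832, road `K2_Liu`, Road I organ (A-int)-fin, A7-reg (GK COCYCLE road), file B1b-2a
(K2Liu-p09 (g5) «B1b NEEDS (for B4)» 2026-09-04T08:15:32Z (4): the coordinate map onto `N_Δ(F_v)` at `n = 2`).
-/
import Summits.HodgeConjecture.HodgeConjecture.Theorems.K2LiuDoubledUTwoTwoFrameTransport      -- ★ B1b-1 `toLocalFour`, `adapt_matA_frameConj`, …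
import Summits.HodgeConjecture.HodgeConjecture.Theorems.K2LiuUnipDeltaRankOneCoordinates       -- ★ `conjLocal_coord`, `existsUnique_coord_of_conjLocal_eq_neg`
import HarnessLib

/-!
# Crux `HLiu418`, road `K2_Liu`, organ (A-int)-fin, A7-reg file B1b-2a: THE SIEGEL UNIPOTENT OF `U(J₄)` IS CARRIED ONTO `N_Δ(F_v)` —
# surjectivity of `(x,z,y) ↦ Q n(x,z,y) Q⁻¹`, the `Δ⁻ → Δ` corner of the image, and the additive coordinates `x = ι_v(b₁)δ`, `y = ι_v(b₂)δ`

Cell `hodgecm-mathlib`, crux item hLiu418 = `stmt-HodgeConjecture-24832`; squad K2 ∕ K2Liu; prover K2Liu-p03 (g6).  THEOREMS ONLY (no `def`, no instance,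
no notation, no named-fact hypothesis, no `sorry`); lane `--supports stmt-HodgeConjecture-24832 --as helper`.

Setting of ★ B1b-1 `K2LiuDoubledUTwoTwoFrameTransport` (`H_v = U(T₂ ⊕ −T₂)(F_v)` on `localPi E c (2+2) J₂D v`, rational frame `Q = e₂∘(1 D; 1 −D)` with `D Dinv = Dinv D = 1`,
`frameConj Q : U(J₄)(F_v) ≃ₜ* H_v`, B1a's letters `nSiegel x z y ∈ U(J₄)(E ⊗ F_v)` through `toLocalFour`).
* §1 **`blkB_matA_frameConj_nSiegel`**: the `Δ⁻ → Δ` corner of `Q n(x,z,y) Q⁻¹` is `X · Dinv_v`, `X = (z y; x −σz)`.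
* §2 **`exists_nSiegel_of_mem_unipDeltaLocal`** — SURJECTIVITY: every `u ∈ N_Δ(F_v)` is `Q n(x,z,y) Q⁻¹` (inverse formula `M′ = diag(1,Dinv)·adapt(matA u)·diag(1,D)` + ★ B1a-2
  `exists_eq_nSiegel`); with §1, `(x,z,y)` is unique (`nSiegel_injective`).
* §3 the ADDITIVE COORDINATES: `x = ι_v(b₁)·δ`, `y = ι_v(b₂)·δ` (★ rank-one `conjLocal_coord`, `existsUnique_coord_of_conjLocal_eq_neg`): the map
  `(b₁, z, b₂) ↦ Q n(ι_v(b₁)δ, z, ι_v(b₂)δ) Q⁻¹`, `F_v × (E ⊗ F_v) × F_v → N_Δ(F_v)`, is additive-to-multiplicative, injective and surjective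
  (`coordTwo_add`, `coordTwo_injective`, `exists_coordTwo_eq`) — the bijection behind the Haar factorisation `νN ↔ db₁ dz db₂` (file B1b-2b).
HONEST LABEL.  Count-neutral helper: `HC_CM` is proved only modulo the 7 printed citations (2 remaining named inputs: hLiu418 = `stmt-HodgeConjecture-24832`,
h413 = `stmt-HodgeConjecture-24833`) until rung 0 closes.

## References
* [HarrisKudlaSweet1996] M. Harris, S. Kudla, W. J. Sweet, J. AMS 9 (1996): §1 (1.11)–(1.12) (`N_Δ ≅ Herm_n`).
* [Weil1965] A. Weil, *L'intégration dans les groupes topologiques* (1965): §37.   * [Casselman1980] W. Casselman, Compositio Math. 40 (1980): §3.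
-/

set_option autoImplicit false
set_option linter.dupNamespace false -- the mandated namespace repeats `HodgeConjecture.HodgeConjecture`

noncomputable section

open NumberField IsDedekindDomain Matrix
open Literature.NumberTheory.Automorphic Literature.NumberTheory.Automorphic.UnitaryGroup
open Literature.NumberTheory.GelbartRogawski1991.AdaptedBlocks
open Literature.NumberTheory.GelbartRogawski1991.UnitaryDualPair.LocalSplitting
open Literature.NumberTheory.K2Lit.LocalSiegelDoubled
open Summit.HodgeConjecture.HodgeConjecture.Cruxes.HLiu418.K2LiuLocalSiegelIwasawa
open Summit.HodgeConjecture.HodgeConjecture.Cruxes.HLiu418.K2LiuDoubledUTwoTwoBorelFrame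
open Summit.HodgeConjecture.HodgeConjecture.Cruxes.HLiu418.K2LiuDoubledUTwoTwoWeylCocycle
open Summit.HodgeConjecture.HodgeConjecture.Cruxes.HLiu418.K2LiuDoubledUTwoTwoFrameTransport
open Summit.HodgeConjecture.HodgeConjecture.Cruxes.HLiu418.K2LiuUnipDeltaRankOneCoordinates

namespace Summit.HodgeConjecture.HodgeConjecture.Cruxes.HLiu418.K2LiuDoubledUTwoTwoUnipotentCoordinates

variable (F : Type) [Field F] [NumberField F] (E : Type) [Field E] [NumberField E] [Algebra F E]
  [Algebra.IsQuadraticExtension F E] (c : E ≃ₐ[F] E)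
  {δ : E} (hcδ : c δ = -δ) (hδ : δ ≠ 0) (v : HeightOneSpectrum (𝓞 F))
  {T₂ : Matrix (Fin 2) (Fin 2) F} {J₂D : Matrix (Fin (2 + 2)) (Fin (2 + 2)) E} (hJ₂D : J₂D = (gramD F 2 T₂).map (algebraMap F E))
  (D Dinv : Matrix (Fin 2) (Fin 2) F) (hDD : D * Dinv = 1) (hDD' : Dinv * D = 1) (Q : GL (Fin (2 + 2)) F)
  (hQm : (Q : Matrix (Fin (2 + 2)) (Fin (2 + 2)) F) = Matrix.reindex (e₂ 2) (e₂ 2) (Matrix.fromBlocks 1 D 1 (-D)))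
  (hQ : (Q : Matrix (Fin (2 + 2)) (Fin (2 + 2)) F)ᵀ * gramD F 2 T₂ * (Q : Matrix (Fin (2 + 2)) (Fin (2 + 2)) F) = (StdForm.antidiagonal (2 + 2)).over F)

/-! ## §1 The `Δ⁻ → Δ` corner of the transported Siegel unipotent -/

include hJ₂D hDD hQm in
/-- **`B(Q n(x,z,y) Q⁻¹) = X · Dinv_v`**, `X = (z y; x −σz)` (the adapted `Δ⁻ → Δ` block ★ `blkB`). [cite: HarrisKudlaSweet1996, §1 (1.11)] -/
theorem blkB_matA_frameConj_nSiegel (x z y : UnitaryGroup.LocalRing E v) (hx : UnitaryGroup.conjLocal E c v x = -x) (hy : UnitaryGroup.conjLocal E c v y = -y) :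
    blkB (matA F E c v 2 (FrameTransport.frameConj F E c v (2 + 2) hJ₂D (antidiagonal_over_eq_map F E 2) Q hQ
        (toLocalFour F E c v (nSiegel (UnitaryGroup.LocalRing E v) (UnitaryGroup.conjLocal E c v) (UnitaryGroup.conjLocal_conjLocal c v hcδ hδ) x z y hx hy)))) =
      !![z, y; x, -UnitaryGroup.conjLocal E c v z] * Dinv.map ((UnitaryGroup.toLocalRing E v).comp (algebraMap F (v.adicCompletion F))) := by
  have h := adapt_matA_frameConj_nSiegel F E c hcδ hδ v hJ₂D D Dinv hDD Q hQm hQ x z y hx hy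
  rw [adapt_eq] at h
  exact (Matrix.fromBlocks_inj.1 h).2.1

/-! ## §2 Surjectivity onto `N_Δ(F_v)` -/

omit [NumberField F] [Algebra.IsQuadraticExtension F E] in
/-- entries of `reindex e₂ e₂ N` for a blocked `4 × 4` matrix (computation). [folklore] -/
theorem reindex_e₂_two_eq (N : Matrix (Fin 2 ⊕ Fin 2) (Fin 2 ⊕ Fin 2) (UnitaryGroup.LocalRing E v)) :
    Matrix.reindex (e₂ 2) (e₂ 2) N =
      !![N (Sum.inl 0) (Sum.inl 0), N (Sum.inl 0) (Sum.inl 1), N (Sum.inl 0) (Sum.inr 0), N (Sum.inl 0) (Sum.inr 1);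
         N (Sum.inl 1) (Sum.inl 0), N (Sum.inl 1) (Sum.inl 1), N (Sum.inl 1) (Sum.inr 0), N (Sum.inl 1) (Sum.inr 1);
         N (Sum.inr 0) (Sum.inl 0), N (Sum.inr 0) (Sum.inl 1), N (Sum.inr 0) (Sum.inr 0), N (Sum.inr 0) (Sum.inr 1);
         N (Sum.inr 1) (Sum.inl 0), N (Sum.inr 1) (Sum.inl 1), N (Sum.inr 1) (Sum.inr 0), N (Sum.inr 1) (Sum.inr 1)] := by
  ext i j; fin_cases i <;> fin_cases j <;> rfl


include hJ₂D hDD hDD' hQm in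
/-- **EVERY `u ∈ N_Δ(F_v)` IS A TRANSPORTED SIEGEL UNIPOTENT `Q n(x,z,y) Q⁻¹`**: the blocked matrix of `(frameConj Q ∘ toLocalFour)⁻¹ u` is
`diag(1, Dinv_v) · (1 t; 0 1) · diag(1, D_v) = (1, t·D_v; 0, 1)` (★ B1b-1 `adapt_matA_frameConj`), hence block-unitriangular, hence some `n(x,z,y)` (★ B1a-2 `exists_eq_nSiegel`).
[cite: HarrisKudlaSweet1996, §1 (1.11)] -/
theorem exists_nSiegel_of_mem_unipDeltaLocal {u : UnitaryGroup.localPi E c (2 + 2) J₂D v} (hu : u ∈ unipDeltaLocal F E c v 2 (JD := J₂D)) :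
    ∃ (x z y : UnitaryGroup.LocalRing E v) (hx : UnitaryGroup.conjLocal E c v x = -x) (hy : UnitaryGroup.conjLocal E c v y = -y),
      u = FrameTransport.frameConj F E c v (2 + 2) hJ₂D (antidiagonal_over_eq_map F E 2) Q hQ
        (toLocalFour F E c v (nSiegel (UnitaryGroup.LocalRing E v) (UnitaryGroup.conjLocal E c v) (UnitaryGroup.conjLocal_conjLocal c v hcδ hδ) x z y hx hy)) := by
  set φ : F →+* UnitaryGroup.LocalRing E v := (UnitaryGroup.toLocalRing E v).comp (algebraMap F (v.adicCompletion F)) with hφ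
  obtain ⟨t, ht⟩ := hu
  -- the preimage `g′ ∈ U(J₄)(E ⊗ F_v)` and its blocked matrix
  set g' := (toLocalFour F E c v).symm ((FrameTransport.frameConj F E c v (2 + 2) hJ₂D (antidiagonal_over_eq_map F E 2) Q hQ).symm u) with hg'
  have hu' : FrameTransport.frameConj F E c v (2 + 2) hJ₂D (antidiagonal_over_eq_map F E 2) Q hQ (toLocalFour F E c v g') = u := by
    rw [hg', ContinuousMulEquiv.apply_symm_apply, ContinuousMulEquiv.apply_symm_apply]
  have hdiag : Matrix.fromBlocks (1 : Matrix (Fin 2) (Fin 2) (UnitaryGroup.LocalRing E v)) 0 0 (D.map φ) * Matrix.fromBlocks 1 0 0 (Dinv.map φ) = 1 := by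
    rw [Matrix.fromBlocks_multiply, ← Matrix.map_mul, hDD, Matrix.map_one _ (map_zero φ) (map_one φ), ← Matrix.fromBlocks_one]; simp
  have hdiag' : Matrix.fromBlocks (1 : Matrix (Fin 2) (Fin 2) (UnitaryGroup.LocalRing E v)) 0 0 (Dinv.map φ) * Matrix.fromBlocks 1 0 0 (D.map φ) = 1 := by
    rw [Matrix.fromBlocks_multiply, ← Matrix.map_mul, hDD', Matrix.map_one _ (map_zero φ) (map_one φ), ← Matrix.fromBlocks_one]; simp
  have hM' : Matrix.reindex (e₂ 2).symm (e₂ 2).symm ((g' : GL (Fin 4) (UnitaryGroup.LocalRing E v)).1) =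
      Matrix.fromBlocks 1 (t * D.map φ) 0 1 := by
    have h := adapt_matA_frameConj F E c v 2 hJ₂D D Dinv hDD Q hQm hQ (toLocalFour F E c v g')
    rw [hu', ht, matS_toLocalFour] at h
    -- `M′ = diag(1,Dinv) (1 t; 0 1) diag(1,D)`
    have h2 := congrArg (fun M => Matrix.fromBlocks (1 : Matrix (Fin 2) (Fin 2) (UnitaryGroup.LocalRing E v)) 0 0 (Dinv.map φ) * M *
      Matrix.fromBlocks (1 : Matrix (Fin 2) (Fin 2) (UnitaryGroup.LocalRing E v)) 0 0 (D.map φ)) h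
    rw [show Matrix.fromBlocks (1 : Matrix (Fin 2) (Fin 2) (UnitaryGroup.LocalRing E v)) 0 0 (Dinv.map φ) *
        (Matrix.fromBlocks 1 0 0 (D.map φ) * Matrix.reindex (e₂ 2).symm (e₂ 2).symm ((g' : GL (Fin 4) (UnitaryGroup.LocalRing E v)).1) * Matrix.fromBlocks 1 0 0 (Dinv.map φ)) *
        Matrix.fromBlocks 1 0 0 (D.map φ) =
        (Matrix.fromBlocks (1 : Matrix (Fin 2) (Fin 2) (UnitaryGroup.LocalRing E v)) 0 0 (Dinv.map φ) * Matrix.fromBlocks 1 0 0 (D.map φ)) *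
          Matrix.reindex (e₂ 2).symm (e₂ 2).symm ((g' : GL (Fin 4) (UnitaryGroup.LocalRing E v)).1) *
          (Matrix.fromBlocks 1 0 0 (Dinv.map φ) * Matrix.fromBlocks 1 0 0 (D.map φ)) by simp only [Matrix.mul_assoc], hdiag', Matrix.one_mul,
      Matrix.mul_one] at h2
    have hDDφ' : Dinv.map φ * D.map φ = 1 := by rw [← Matrix.map_mul, hDD', Matrix.map_one _ (map_zero φ) (map_one φ)]
    rw [← h2, Matrix.fromBlocks_multiply, Matrix.fromBlocks_multiply]
    simp only [Matrix.mul_one, Matrix.one_mul, Matrix.mul_zero, Matrix.zero_mul, add_zero, zero_add, hDDφ']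
  -- read off the twelve structural entries
  have hcoe : ((g' : GL (Fin 4) (UnitaryGroup.LocalRing E v)).1) =
      Matrix.reindex (e₂ 2) (e₂ 2) (Matrix.fromBlocks (1 : Matrix (Fin 2) (Fin 2) (UnitaryGroup.LocalRing E v)) (t * D.map φ) 0 1) := by
    rw [← hM', Matrix.reindex_apply, Matrix.reindex_apply, Matrix.submatrix_submatrix, Equiv.symm_symm, Equiv.self_comp_symm, Matrix.submatrix_id_id]
  rw [reindex_e₂_two_eq] at hcoe
  obtain ⟨x, z, y, hx, hy, hg⟩ := exists_eq_nSiegel (UnitaryGroup.LocalRing E v) (UnitaryGroup.conjLocal E c v)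
    (UnitaryGroup.conjLocal_conjLocal c v hcδ hδ) g'
    (by rw [hcoe]; simp) (by rw [hcoe]; simp) (by rw [hcoe]; simp) (by rw [hcoe]; simp) (by rw [hcoe]; simp) (by rw [hcoe]; simp)
    (by rw [hcoe]; simp) (by rw [hcoe]; simp) (by rw [hcoe]; simp) (by rw [hcoe]; simp) (by rw [hcoe]; simp) (by rw [hcoe]; simp)
  exact ⟨x, z, y, hx, hy, by rw [← hu', hg]⟩

/-! ## §3 The additive coordinates `(b₁, z, b₂) ↦ Q n(ι_v(b₁)δ, z, ι_v(b₂)δ) Q⁻¹` -/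

include hJ₂D hDD hQm in
/-- **the coordinate element `Q n(ι_v(b₁)δ, z, ι_v(b₂)δ) Q⁻¹ ∈ N_Δ(F_v)`** (membership). [cite: HarrisKudlaSweet1996, §1 (1.11)] -/
theorem coordTwo_mem (b₁ : v.adicCompletion F) (z : UnitaryGroup.LocalRing E v) (b₂ : v.adicCompletion F) :
    FrameTransport.frameConj F E c v (2 + 2) hJ₂D (antidiagonal_over_eq_map F E 2) Q hQ
        (toLocalFour F E c v (nSiegel (UnitaryGroup.LocalRing E v) (UnitaryGroup.conjLocal E c v) (UnitaryGroup.conjLocal_conjLocal c v hcδ hδ)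
          (UnitaryGroup.toLocalRing E v b₁ * algebraMap E (UnitaryGroup.LocalRing E v) δ) z
          (UnitaryGroup.toLocalRing E v b₂ * algebraMap E (UnitaryGroup.LocalRing E v) δ)
          (conjLocal_coord F E c hcδ v b₁) (conjLocal_coord F E c hcδ v b₂))) ∈
      unipDeltaLocal F E c v 2 (JD := J₂D) :=
  frameConj_nSiegel_mem_unipDeltaLocal F E c hcδ hδ v hJ₂D D Dinv hDD Q hQm hQ _ z _ _ _

set_option maxHeartbeats 800000 in -- the nested `frameConj (toLocalFour (nSiegel …))` terms unfold slowly
/-- **additivity of the coordinate**: `(b₁,z,b₂) + (b₁′,z′,b₂′) ↦` the product (`nSiegel_mul` through the two isomorphisms).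
[cite: HarrisKudlaSweet1996, §1 (1.11)] -/
theorem coordTwo_add (b₁ : v.adicCompletion F) (z : UnitaryGroup.LocalRing E v) (b₂ : v.adicCompletion F)
    (b₁' : v.adicCompletion F) (z' : UnitaryGroup.LocalRing E v) (b₂' : v.adicCompletion F) :
    FrameTransport.frameConj F E c v (2 + 2) hJ₂D (antidiagonal_over_eq_map F E 2) Q hQ
        (toLocalFour F E c v (nSiegel (UnitaryGroup.LocalRing E v) (UnitaryGroup.conjLocal E c v) (UnitaryGroup.conjLocal_conjLocal c v hcδ hδ)
          (UnitaryGroup.toLocalRing E v (b₁ + b₁') * algebraMap E (UnitaryGroup.LocalRing E v) δ) (z + z')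
          (UnitaryGroup.toLocalRing E v (b₂ + b₂') * algebraMap E (UnitaryGroup.LocalRing E v) δ)
          (conjLocal_coord F E c hcδ v (b₁ + b₁')) (conjLocal_coord F E c hcδ v (b₂ + b₂')))) =
      FrameTransport.frameConj F E c v (2 + 2) hJ₂D (antidiagonal_over_eq_map F E 2) Q hQ
          (toLocalFour F E c v (nSiegel (UnitaryGroup.LocalRing E v) (UnitaryGroup.conjLocal E c v) (UnitaryGroup.conjLocal_conjLocal c v hcδ hδ)
            (UnitaryGroup.toLocalRing E v b₁ * algebraMap E (UnitaryGroup.LocalRing E v) δ) z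
            (UnitaryGroup.toLocalRing E v b₂ * algebraMap E (UnitaryGroup.LocalRing E v) δ)
            (conjLocal_coord F E c hcδ v b₁) (conjLocal_coord F E c hcδ v b₂))) *
        FrameTransport.frameConj F E c v (2 + 2) hJ₂D (antidiagonal_over_eq_map F E 2) Q hQ
          (toLocalFour F E c v (nSiegel (UnitaryGroup.LocalRing E v) (UnitaryGroup.conjLocal E c v) (UnitaryGroup.conjLocal_conjLocal c v hcδ hδ)
            (UnitaryGroup.toLocalRing E v b₁' * algebraMap E (UnitaryGroup.LocalRing E v) δ) z'
            (UnitaryGroup.toLocalRing E v b₂' * algebraMap E (UnitaryGroup.LocalRing E v) δ)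
            (conjLocal_coord F E c hcδ v b₁') (conjLocal_coord F E c hcδ v b₂'))) := by
  have hn : nSiegel (UnitaryGroup.LocalRing E v) (UnitaryGroup.conjLocal E c v) (UnitaryGroup.conjLocal_conjLocal c v hcδ hδ)
        (UnitaryGroup.toLocalRing E v (b₁ + b₁') * algebraMap E (UnitaryGroup.LocalRing E v) δ) (z + z')
        (UnitaryGroup.toLocalRing E v (b₂ + b₂') * algebraMap E (UnitaryGroup.LocalRing E v) δ)
        (conjLocal_coord F E c hcδ v (b₁ + b₁')) (conjLocal_coord F E c hcδ v (b₂ + b₂')) =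
      nSiegel (UnitaryGroup.LocalRing E v) (UnitaryGroup.conjLocal E c v) (UnitaryGroup.conjLocal_conjLocal c v hcδ hδ)
        (UnitaryGroup.toLocalRing E v b₁ * algebraMap E (UnitaryGroup.LocalRing E v) δ) z
        (UnitaryGroup.toLocalRing E v b₂ * algebraMap E (UnitaryGroup.LocalRing E v) δ)
        (conjLocal_coord F E c hcδ v b₁) (conjLocal_coord F E c hcδ v b₂) *
      nSiegel (UnitaryGroup.LocalRing E v) (UnitaryGroup.conjLocal E c v) (UnitaryGroup.conjLocal_conjLocal c v hcδ hδ)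
        (UnitaryGroup.toLocalRing E v b₁' * algebraMap E (UnitaryGroup.LocalRing E v) δ) z'
        (UnitaryGroup.toLocalRing E v b₂' * algebraMap E (UnitaryGroup.LocalRing E v) δ)
        (conjLocal_coord F E c hcδ v b₁') (conjLocal_coord F E c hcδ v b₂') := by
    rw [nSiegel_mul]
    apply ext_of_coe
    rw [coe_nSiegel, coe_nSiegel]
    simp only [map_add, add_mul]
  rw [hn, map_mul, map_mul]

set_option maxHeartbeats 800000 in -- as above
include hδ in
/-- **injectivity of the coordinate**. [cite: HarrisKudlaSweet1996, §1 (1.11)] -/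
theorem coordTwo_injective {b₁ b₁' : v.adicCompletion F} {z z' : UnitaryGroup.LocalRing E v} {b₂ b₂' : v.adicCompletion F}
    (h : FrameTransport.frameConj F E c v (2 + 2) hJ₂D (antidiagonal_over_eq_map F E 2) Q hQ
        (toLocalFour F E c v (nSiegel (UnitaryGroup.LocalRing E v) (UnitaryGroup.conjLocal E c v) (UnitaryGroup.conjLocal_conjLocal c v hcδ hδ)
          (UnitaryGroup.toLocalRing E v b₁ * algebraMap E (UnitaryGroup.LocalRing E v) δ) z
          (UnitaryGroup.toLocalRing E v b₂ * algebraMap E (UnitaryGroup.LocalRing E v) δ)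
          (conjLocal_coord F E c hcδ v b₁) (conjLocal_coord F E c hcδ v b₂))) =
      FrameTransport.frameConj F E c v (2 + 2) hJ₂D (antidiagonal_over_eq_map F E 2) Q hQ
        (toLocalFour F E c v (nSiegel (UnitaryGroup.LocalRing E v) (UnitaryGroup.conjLocal E c v) (UnitaryGroup.conjLocal_conjLocal c v hcδ hδ)
          (UnitaryGroup.toLocalRing E v b₁' * algebraMap E (UnitaryGroup.LocalRing E v) δ) z'
          (UnitaryGroup.toLocalRing E v b₂' * algebraMap E (UnitaryGroup.LocalRing E v) δ)
          (conjLocal_coord F E c hcδ v b₁') (conjLocal_coord F E c hcδ v b₂')))) :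
    b₁ = b₁' ∧ z = z' ∧ b₂ = b₂' := by
  have h1 := (toLocalFour F E c v).injective ((FrameTransport.frameConj F E c v (2 + 2) hJ₂D (antidiagonal_over_eq_map F E 2) Q hQ).injective h)
  obtain ⟨hx, hz, hy⟩ := nSiegel_injective (UnitaryGroup.LocalRing E v) (UnitaryGroup.conjLocal E c v) (UnitaryGroup.conjLocal_conjLocal c v hcδ hδ) _ _ _ _ h1
  exact ⟨coord_injective F E v hδ hx, hz, coord_injective F E v hδ hy⟩

set_option maxHeartbeats 800000 in -- as above
include hJ₂D hDD hDD' hQm in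
/-- **surjectivity of the coordinate**: every `u ∈ N_Δ(F_v)` is `Q n(ι_v(b₁)δ, z, ι_v(b₂)δ) Q⁻¹`. [cite: HarrisKudlaSweet1996, §1 (1.11)] -/
theorem exists_coordTwo_eq {u : UnitaryGroup.localPi E c (2 + 2) J₂D v} (hu : u ∈ unipDeltaLocal F E c v 2 (JD := J₂D)) :
    ∃ (b₁ : v.adicCompletion F) (z : UnitaryGroup.LocalRing E v) (b₂ : v.adicCompletion F),
      u = FrameTransport.frameConj F E c v (2 + 2) hJ₂D (antidiagonal_over_eq_map F E 2) Q hQ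
        (toLocalFour F E c v (nSiegel (UnitaryGroup.LocalRing E v) (UnitaryGroup.conjLocal E c v) (UnitaryGroup.conjLocal_conjLocal c v hcδ hδ)
          (UnitaryGroup.toLocalRing E v b₁ * algebraMap E (UnitaryGroup.LocalRing E v) δ) z
          (UnitaryGroup.toLocalRing E v b₂ * algebraMap E (UnitaryGroup.LocalRing E v) δ)
          (conjLocal_coord F E c hcδ v b₁) (conjLocal_coord F E c hcδ v b₂))) := by
  obtain ⟨x, z, y, hx, hy, hu'⟩ := exists_nSiegel_of_mem_unipDeltaLocal F E c hcδ hδ v hJ₂D D Dinv hDD hDD' Q hQm hQ hu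
  obtain ⟨b₁, hb₁, -⟩ := existsUnique_coord_of_conjLocal_eq_neg F E c hcδ hδ v hx
  obtain ⟨b₂, hb₂, -⟩ := existsUnique_coord_of_conjLocal_eq_neg F E c hcδ hδ v hy
  subst hb₁ hb₂
  exact ⟨b₁, z, b₂, hu'⟩

end Summit.HodgeConjecture.HodgeConjecture.Cruxes.HLiu418.K2LiuDoubledUTwoTwoUnipotentCoordinates

end
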